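import Literature.AlgebraicGeometry.Frobenioids.Frobenioid

/-!
# Kernel DAG index — layer L1, part w (GENERATED by abc-iut-c312-2 gen 3 `work/gen_index.py` @2026-08-26T02:29Z from HOME/plan/DAG.tsv +
KERNEL-DAG-MODULES.tsv (regenerated 2026-08-26T01:59:04Z): 3 landed/discharged nodes NOT YET in the tree index Summits/ABC/IUTFork/DAG*.lean; spec v1.3 §2 (M))

THIS FILE PROVES NOTHING NEW AND ASSERTS NOTHING (HOME/plan/KERNEL-DAG-SPEC.md). It gives ONE NAME `N_<kernel_id>` to each DAG node whose
statement has LANDED through the gate, knitting the landed declarations BY NAME: claim nodes `N_<id> : Prop := StatementOf @thm₁ ∧ …` (one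
conjunct per landed theorem the DAG row names, universe levels instantiated explicitly per the spec's UNIVERSE RULE, arities read off the farm),
witnessed `N_<id>_holds` iff the DAG row is `discharged(p…)` and `N_<id>_part` otherwise (spec §2(b),(c); c312-2 F1/F2); data nodes
`abbrev N_<id> := @<primary>` with the row's further declarations as `example := @…` lines; FACT-style `def … : Prop` declarations are data
here (a NAME, never asserted). Decl lists come from the `decls` column of plan/DAG.tsv as resolved against the tree sources (unresolvable
tokens dropped and reported to abc-iut-dag on STATUS). Nothing here says abc is proved or refuted or takes a side on [IUTchIII] Cor 3.12.
typed ≠ discharged; indexed ≠ endorsed.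
-/

namespace Summit.ABC.IUTFork.DAG

namespace PartL1w
/-- `StatementOf h` is the statement (a `Prop`) of which the landed `h` is the proof: the index NAMES statements, it never re-types them. -/
abbrev StatementOf {P : Prop} (_h : P) : Prop := P
end PartL1w
open PartL1w

noncomputable section
universe u₁ u₂ u₃ u₄ u₅ u₆ u₇ u₈ u₉ u₁₀ u₁₁ u₁₂ u₁₃ u₁₄ u₁₅ u₁₆


/-- [node FrdI:Def1.3(ii) · L1/D1 · [FrdI] Def 1.3 (ii), kurims p.24 · p404769 · data · DAG status discharged(p404769)] decls 1 · cites→ FrdI:Def1.2 · decls matched by docstring locator -/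
abbrev N_FrdI_Def1_3_ii := @Literature.AlgebraicGeometry.Frobenioids.PreFrobenioid.IsFrobenioid.{u₁, u₂, u₃, u₄, u₅}

/-- [node FrdI:Def1.3(iv) · L1/D1 · [FrdI] Def 1.3 (iv), kurims p.24 · p404769 · data · DAG status discharged(p404769)] decls 1 · cites→ FrdI:Def1.2 · decls matched by docstring locator -/
abbrev N_FrdI_Def1_3_iv := @Literature.AlgebraicGeometry.Frobenioids.PreFrobenioid.IsFrobenioid.{u₁, u₂, u₃, u₄, u₅}

/-- [node FrdI:Def1.3(vi) · L1/D1 · [FrdI] Def 1.3 (vi), kurims p.24 · p404769 · data · DAG status discharged(p404769)] decls 1 · cites→ FrdI:Def1.2 · decls matched by docstring locator -/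
abbrev N_FrdI_Def1_3_vi := @Literature.AlgebraicGeometry.Frobenioids.PreFrobenioid.IsFrobenioid.{u₁, u₂, u₃, u₄, u₅}

end

end Summit.ABC.IUTFork.DAG
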